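import Mathlib
import HarnessLib
import Summits.Ventures.LatticeQCDFlow.Scaling.AcceptanceEssEightNinthsDeficit

/-!
# LatticeQCDFlow / Scaling — the `acc ≥ (8/9)·ESS` law on a general space, IV: RIGIDITY —
# equality holds iff the weight's survival function IS the tent `(4Z²/(3W) − (8Z³/(9W²))·t)₊`

HONEST FRAMING: exact (Metropolis-corrected) sampling algorithms for lattice gauge theory;
figures of merit are autocorrelation/cost numbers at stated couplings and volumes; no
continuum-physics claim.

Venture `LatticeQCDFlow` (cell pub-lqcd), topic `Scaling`; FANOUT row 3 (`s0-u1-a`, S0-B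
implementation A, GEN-12).  NEW WORK of the cell, not a published result; NO definition is
introduced.  Part III (`Scaling/AcceptanceEssEightNinthsDeficit`, imported) wrote the general-space
8/9 law as the identity `∫∫ min(b,b′)ρρ′ = (8/9)Z³/W + l·∫ (b − 3W/(2Z))₊² ρ + ∫ ((S ∸ g)² +
(g ∸ S)²) dν` (`S(t) = ∫ 𝟙(t < b)ρ dμ`, `g` the optimal tent, `ν` Lebesgue measure on `(0, ∞)`).
This file reads off the EQUALITY CASE — listed NOT CLAIMED in row 3's files since GEN-9, where
only the attainment (`…IntegralWitness`, `…IntegralZeroRamp`: the ramp and every zero-inflated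
ramp attain `8/9`) was proved:

* `lintegral_tsub_sq_add_eq_zero_iff` — `∫ ((S ∸ g)² + (g ∸ S)²) dν = 0 ↔ S = g` `ν`-a.e.;
* `antitone_survival` — `t ↦ ∫ 𝟙(t < b)ρ dμ` is antitone;
* **`eq_tent_of_ae_eq`** — an ANTITONE `S : ℝ → ℝ≥0∞` equal to `ofReal (c − l t)` (`l > 0`) for
  a.e. `t > 0` equals it for EVERY `t > 0` (full-measure sets meet every interval; squeeze `S(t)`
  between good points on either side, where the tent moves by at most `l·δ`);
* **`overlap_eq_eight_ninths_iff`** — RIGIDITY: for a measurable weight `b ≥ 0` and density `ρ`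
  with `Z = ∫ bρ`, `W = ∫ b²ρ` finite positive,
  `∫∫ min(b,b′)ρρ′ = (8/9)·Z³/W  ↔  ∀ t > 0, ∫ 𝟙(t < b)ρ dμ = (4Z²/(3W) − (8Z³/(9W²))·t)₊`,
  i.e. iff the law of `b` under `ρ dμ` restricted to `(0, ∞)` is the FLAT density `8Z³/(9W²)` on
  `(0, 3W/(2Z)]` (total mass `4Z²/(3W)`, the rest of `ρ` sitting at `b = 0`): the zero-inflated
  ramps of the witness files are ALL the extremisers;
* `overlap_gt_eight_ninths_of_not_tent` — contrapositive: any other weight law accepts STRICTLY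
  more than `(8/9)Z³/W`.

Reading for the samplers (value-free; `b = w/q` the importance weight under the model `q`,
`Z = 1`, `W = 1/ESS`): an exact flow sampler sits ON the floor `acc = (8/9)·ESS` precisely when
its weight law under the model is an atom at `0` of mass `1 − (4/3)·ESS` plus a uniform density on
`(0, 3/(2·ESS)]`; since that mass must be nonnegative, equality forces `ESS ≤ 3/4`, and every flow
whose weight law is not of this form — in particular every flow with `ESS > 3/4`, or with weights
bounded away from `0` — accepts strictly more often than `(8/9)·ESS`.  NOT CLAIMED: the sharp
envelope for `ESS > 3/4` on a general space (finite: row 3's `Scaling/AcceptanceEssEnvelope`); any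
acceptance or ESS of ours; nothing re-scored.
-/

namespace Summit.Ventures.LatticeQCDFlow.Theory2

open MeasureTheory ENNReal Set Filter

/-! ### Zero deficit means almost-everywhere equality -/

/-- `∫ ((S ∸ g)² + (g ∸ S)²) dν = 0 ↔ S = g` `ν`-almost everywhere (measurable `S, g`). [folklore] -/
theorem lintegral_tsub_sq_add_eq_zero_iff {S g : ℝ → ℝ≥0∞} (hS : Measurable S) (hg : Measurable g)
    (ν : Measure ℝ) :
    ∫⁻ t, ((S t - g t) ^ 2 + (g t - S t) ^ 2) ∂ν = 0 ↔ S =ᵐ[ν] g := by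
  have hm : Measurable fun t => (S t - g t) ^ 2 + (g t - S t) ^ 2 :=
    ((hS.sub hg).pow_const 2).add ((hg.sub hS).pow_const 2)
  rw [lintegral_eq_zero_iff hm]
  constructor
  · intro h
    filter_upwards [h] with t ht
    have h1 : (S t - g t) ^ 2 = 0 := le_antisymm (le_of_le_of_eq le_self_add ht) bot_le
    have h2 : (g t - S t) ^ 2 = 0 := le_antisymm (le_of_le_of_eq le_add_self ht) bot_le
    rw [pow_eq_zero_iff two_ne_zero, tsub_eq_zero_iff_le] at h1 h2
    exact le_antisymm h1 h2
  · intro h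
    filter_upwards [h] with t ht
    simp [ht]

/-! ### An antitone function equal to a tent almost everywhere equals it everywhere -/

/-- **A.e. tent ⇒ everywhere tent for antitone functions.**  If `S : ℝ → ℝ≥0∞` is antitone and
`S(t) = ofReal (c − l t)` for Lebesgue-a.e. `t > 0` (`l > 0`), then `S(t) = ofReal (c − l t)` for
every `t > 0`.  (Every interval of positive length inside `(0, ∞)` contains a point of agreement;
squeeze `S(t)` between agreement points `t′ < t < t″` within `δ` of `t`, where the tent moves by
at most `l δ`, and let `δ → 0` via `ENNReal.le_of_forall_pos_le_add`.) [ours] -/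
theorem eq_tent_of_ae_eq {S : ℝ → ℝ≥0∞} (hS : Antitone S) {c l : ℝ} (hl : 0 < l)
    (h : ∀ᵐ t ∂(volume.restrict (Ioi (0 : ℝ))), S t = ENNReal.ofReal (c - l * t)) :
    ∀ t, 0 < t → S t = ENNReal.ofReal (c - l * t) := by
  -- agreement points are dense in `(0, ∞)`
  have dense : ∀ a a' : ℝ, 0 ≤ a → a < a' → ∃ t ∈ Ioo a a', S t = ENNReal.ofReal (c - l * t) := by
    intro a a' ha haa'
    by_contra hne
    have hsub : Ioo a a' ⊆ {t | ¬ S t = ENNReal.ofReal (c - l * t)} ∩ Ioi 0 :=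
      fun t ht => ⟨fun h' => hne ⟨t, ht, h'⟩, ha.trans_lt ht.1⟩
    have h0 : (volume.restrict (Ioi (0 : ℝ))) {t | ¬ S t = ENNReal.ofReal (c - l * t)} = 0 :=
      ae_iff.1 h
    rw [Measure.restrict_apply' measurableSet_Ioi] at h0
    have hvol : volume (Ioo a a') = 0 := measure_mono_null hsub h0
    rw [Real.volume_Ioo, ENNReal.ofReal_eq_zero] at hvol
    linarith
  intro t ht
  apply le_antisymm
  · -- `S t ≤ g t`: agreement points to the LEFT of `t`
    refine ENNReal.le_of_forall_pos_le_add fun ε hε _ => ?_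
    have hε' : (0 : ℝ) < ε := by exact_mod_cast hε
    set δ : ℝ := min ((ε : ℝ) / l) (t / 2) with hδ
    have hδ0 : 0 < δ := lt_min (div_pos hε' hl) (half_pos ht)
    have hδt : δ ≤ t / 2 := min_le_right _ _
    have hδε : l * δ ≤ ε := by
      calc l * δ ≤ l * ((ε : ℝ) / l) := mul_le_mul_of_nonneg_left (min_le_left _ _) hl.le
        _ = ε := mul_div_cancel₀ _ hl.ne'
    obtain ⟨t', ht', hSt'⟩ := dense (t - δ) t (by linarith) (by linarith)
    calc S t ≤ S t' := hS ht'.2.le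
      _ = ENNReal.ofReal (c - l * t') := hSt'
      _ ≤ ENNReal.ofReal (c - l * t + l * δ) :=
          ENNReal.ofReal_le_ofReal (by nlinarith [ht'.1, hl])
      _ ≤ ENNReal.ofReal (c - l * t) + ENNReal.ofReal (l * δ) := ENNReal.ofReal_add_le
      _ ≤ ENNReal.ofReal (c - l * t) + ε := by
          gcongr
          calc ENNReal.ofReal (l * δ) ≤ ENNReal.ofReal (ε : ℝ) := ENNReal.ofReal_le_ofReal hδε
            _ = ε := ENNReal.ofReal_coe_nnreal
  · -- `g t ≤ S t`: agreement points to the RIGHT of `t`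
    refine ENNReal.le_of_forall_pos_le_add fun ε hε _ => ?_
    have hε' : (0 : ℝ) < ε := by exact_mod_cast hε
    set δ : ℝ := (ε : ℝ) / l with hδ
    have hδ0 : 0 < δ := div_pos hε' hl
    have hδε : l * δ = ε := mul_div_cancel₀ _ hl.ne'
    obtain ⟨t', ht', hSt'⟩ := dense t (t + δ) ht.le (by linarith)
    calc ENNReal.ofReal (c - l * t) ≤ ENNReal.ofReal (c - l * t' + l * δ) :=
          ENNReal.ofReal_le_ofReal (by nlinarith [ht'.2, hl])
      _ ≤ ENNReal.ofReal (c - l * t') + ENNReal.ofReal (l * δ) := ENNReal.ofReal_add_le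
      _ = S t' + ENNReal.ofReal (l * δ) := by rw [hSt']
      _ ≤ S t + ε := by
          gcongr
          · exact hS ht'.1.le
          · rw [hδε, ENNReal.ofReal_coe_nnreal]

/-! ### Rigidity of the 8/9 law -/

section Core

variable {X : Type*} [MeasurableSpace X] {μ : Measure X} [SFinite μ] {b : X → ℝ} {ρ : X → ℝ≥0∞}

omit [SFinite μ] in
/-- The survival mass `t ↦ ∫ 𝟙(t < b)ρ dμ` is antitone. [folklore] -/
theorem antitone_survival :
    Antitone fun t : ℝ => ∫⁻ x, (Iio (b x)).indicator (1 : ℝ → ℝ≥0∞) t * ρ x ∂μ := by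
  intro t t' htt'
  refine lintegral_mono fun x => ?_
  have hind : (Iio (b x)).indicator (1 : ℝ → ℝ≥0∞) t' ≤ (Iio (b x)).indicator 1 t := by
    simp only [Set.indicator_apply, mem_Iio, Pi.one_apply]
    by_cases h' : t' < b x
    · rw [if_pos h', if_pos (htt'.trans_lt h')]
    · rw [if_neg h']
      exact bot_le
  gcongr

/-- **RIGIDITY OF THE 8/9 LAW (general measure space).**  For a measurable weight `b ≥ 0` and a
measurable density `ρ` on an s-finite space with `∫ bρ = Z`, `∫ b²ρ = W` finite and positive:
`∫∫ min(b x, b y) ρ x ρ y = (8/9)·Z³/W` if and only if for EVERY `t > 0`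
`∫ 𝟙(t < b) ρ dμ = (4Z²/(3W) − (8Z³/(9W²))·t)₊` — the `ρ`-law of `b` on `(0, ∞)` is the flat
density `8Z³/(9W²)` on `(0, 3W/(2Z)]`. [ours] -/
theorem overlap_eq_eight_ninths_iff (hb : Measurable b) (hb0 : ∀ x, 0 ≤ b x) (hρ : Measurable ρ)
    {Z W : ℝ} (hZ : 0 < Z) (hW : 0 < W)
    (hm1 : ∫⁻ x, ENNReal.ofReal (b x) * ρ x ∂μ = ENNReal.ofReal Z)
    (hm2 : ∫⁻ x, ENNReal.ofReal (b x ^ 2) * ρ x ∂μ = ENNReal.ofReal W) :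
    ∫⁻ x, ∫⁻ y, ENNReal.ofReal (min (b x) (b y)) * ρ x * ρ y ∂μ ∂μ
        = ENNReal.ofReal (8 * Z ^ 3 / (9 * W))
      ↔ ∀ t : ℝ, 0 < t → ∫⁻ x, (Iio (b x)).indicator (1 : ℝ → ℝ≥0∞) t * ρ x ∂μ
          = ENNReal.ofReal (4 * Z ^ 2 / (3 * W) - 8 * Z ^ 3 / (9 * W ^ 2) * t) := by
  have hx := overlap_eq_eight_ninths_add_excess (μ := μ) hb hb0 hρ hZ hW hm1 hm2
  have hl : (0 : ℝ) < 8 * Z ^ 3 / (9 * W ^ 2) := by positivity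
  -- measurability bookkeeping
  have hI : Measurable fun p : X × ℝ => (Iio (b p.1)).indicator (1 : ℝ → ℝ≥0∞) p.2 :=
    measurable_indicator_Iio_uncurry hb
  have hF : Measurable fun p : X × ℝ => (Iio (b p.1)).indicator (1 : ℝ → ℝ≥0∞) p.2 * ρ p.1 :=
    hI.fun_mul (hρ.comp measurable_fst)
  have hFt : ∀ t, Measurable fun x => (Iio (b x)).indicator (1 : ℝ → ℝ≥0∞) t * ρ x := fun t =>
    hF.comp (measurable_id.prodMk measurable_const)
  have hS : Measurable fun t => ∫⁻ x, (Iio (b x)).indicator (1 : ℝ → ℝ≥0∞) t * ρ x ∂μ :=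
    hF.lintegral_prod_left'
  have hg : Measurable fun t : ℝ =>
      ENNReal.ofReal (4 * Z ^ 2 / (3 * W) - 8 * Z ^ 3 / (9 * W ^ 2) * t) :=
    ((measurable_id.const_mul _).const_sub _).ennreal_ofReal
  have hEm : Measurable fun x => ENNReal.ofReal (max (b x - 3 * W / (2 * Z)) 0 ^ 2) * ρ x :=
    (((hb.sub_const _).max measurable_const).pow_const 2).ennreal_ofReal.fun_mul hρ
  have hDiff := lintegral_tsub_sq_add_eq_zero_iff hS hg (volume.restrict (Ioi (0 : ℝ)))
  constructor
  · intro hO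
    -- the excess vanishes, hence the `L²` deficit vanishes, hence `S = g` a.e., hence everywhere
    have hsum : ENNReal.ofReal (8 * Z ^ 3 / (9 * W ^ 2))
          * (∫⁻ x, ENNReal.ofReal (max (b x - 3 * W / (2 * Z)) 0 ^ 2) * ρ x ∂μ)
        + ∫⁻ t, (((∫⁻ x, (Iio (b x)).indicator (1 : ℝ → ℝ≥0∞) t * ρ x ∂μ)
              - ENNReal.ofReal (4 * Z ^ 2 / (3 * W) - 8 * Z ^ 3 / (9 * W ^ 2) * t)) ^ 2
            + (ENNReal.ofReal (4 * Z ^ 2 / (3 * W) - 8 * Z ^ 3 / (9 * W ^ 2) * t)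
              - ∫⁻ x, (Iio (b x)).indicator (1 : ℝ → ℝ≥0∞) t * ρ x ∂μ) ^ 2)
            ∂(volume.restrict (Ioi 0)) = 0 := by
      refine (ENNReal.add_right_inj (a := ENNReal.ofReal (8 * Z ^ 3 / (9 * W)))
        ENNReal.ofReal_ne_top).1 ?_
      rw [add_zero, ← add_assoc, ← hx, hO]
    have hD := (add_eq_zero.1 hsum).2
    exact eq_tent_of_ae_eq antitone_survival hl (hDiff.1 hD)
  · intro hall
    -- `S = g` everywhere on `(0, ∞)`: both deficits vanish
    have hae : (fun t => ∫⁻ x, (Iio (b x)).indicator (1 : ℝ → ℝ≥0∞) t * ρ x ∂μ)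
        =ᵐ[volume.restrict (Ioi (0 : ℝ))]
          fun t => ENNReal.ofReal (4 * Z ^ 2 / (3 * W) - 8 * Z ^ 3 / (9 * W ^ 2) * t) :=
      (ae_restrict_iff' measurableSet_Ioi).2 (Eventually.of_forall fun t ht => hall t ht)
    have hD := hDiff.2 hae
    -- at the kink `t₀ = 3W/(2Z)` the tent vanishes, so `ρ`-almost no weight exceeds `t₀`
    have ht0 : (0 : ℝ) < 3 * W / (2 * Z) := by positivity
    have hkink : 4 * Z ^ 2 / (3 * W) - 8 * Z ^ 3 / (9 * W ^ 2) * (3 * W / (2 * Z)) = 0 := by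
      field_simp
      ring
    have h0 : ∫⁻ x, (Iio (b x)).indicator (1 : ℝ → ℝ≥0∞) (3 * W / (2 * Z)) * ρ x ∂μ = 0 := by
      rw [hall _ ht0, hkink, ENNReal.ofReal_zero]
    have hE : ∫⁻ x, ENNReal.ofReal (max (b x - 3 * W / (2 * Z)) 0 ^ 2) * ρ x ∂μ = 0 := by
      rw [lintegral_eq_zero_iff (hFt _)] at h0
      refine (lintegral_eq_zero_iff hEm).2 ?_
      filter_upwards [h0] with x hx0
      by_cases hbx : 3 * W / (2 * Z) < b x
      · have hρ0 : ρ x = 0 := by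
          simpa [Set.indicator_apply, mem_Iio, hbx] using hx0
        simp [hρ0]
      · have hm0 : max (b x - 3 * W / (2 * Z)) 0 = 0 := max_eq_right (by linarith)
        simp [hm0]
    rw [hx, hD, hE, mul_zero, add_zero, add_zero]

/-- **Strictness off the tent**: under the same hypotheses, if for some `t > 0` the survival mass
`∫ 𝟙(t < b)ρ dμ` differs from `(4Z²/(3W) − (8Z³/(9W²))·t)₊`, then
`∫∫ min(b, b′)ρρ′ > (8/9)·Z³/W` strictly. [ours] -/
theorem overlap_gt_eight_ninths_of_not_tent (hb : Measurable b) (hb0 : ∀ x, 0 ≤ b x)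
    (hρ : Measurable ρ) {Z W : ℝ} (hZ : 0 < Z) (hW : 0 < W)
    (hm1 : ∫⁻ x, ENNReal.ofReal (b x) * ρ x ∂μ = ENNReal.ofReal Z)
    (hm2 : ∫⁻ x, ENNReal.ofReal (b x ^ 2) * ρ x ∂μ = ENNReal.ofReal W) {t : ℝ} (ht : 0 < t)
    (hne : ∫⁻ x, (Iio (b x)).indicator (1 : ℝ → ℝ≥0∞) t * ρ x ∂μ
      ≠ ENNReal.ofReal (4 * Z ^ 2 / (3 * W) - 8 * Z ^ 3 / (9 * W ^ 2) * t)) :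
    ENNReal.ofReal (8 * Z ^ 3 / (9 * W))
      < ∫⁻ x, ∫⁻ y, ENNReal.ofReal (min (b x) (b y)) * ρ x * ρ y ∂μ ∂μ := by
  refine lt_of_le_of_ne (ofReal_eight_ninths_le_overlap hb hb0 hρ hZ hW hm1 hm2) fun heq => ?_
  exact hne ((overlap_eq_eight_ninths_iff hb hb0 hρ hZ hW hm1 hm2).1 heq.symm t ht)

end Core

end Summit.Ventures.LatticeQCDFlow.Theory2
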